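import Summits.CriticalPhenomena.PercolationContinuityZ3.Theorems.PercNearOneGluingNoHeavyQuantSlabCriterion
import HarnessLib

/-!
# QUANT lane / PAPER-2 rate track (ARM-1): Kozma–Nitzan's Theorem 6, effective, FACTORED THROUGH AN ABSTRACT
# TARGET-LEMMA SCHEMA WITH A FREE MARGIN FUNCTION

builds on p205010 (kernel theorem, internal audit signed; external expert review pending)

Cell `prim-quant`, PAPER-2 track (i) (explicit one-arm rate at `p_c`), seat `prim-quant-arm-1` (rate-theorem architect);
plan `run/shared/lean/prim/quant/RATE-PLAN.md` §2, §3.4 (P1), §6 (F1).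

WHERE THE ITERATED LOGARITHM COMES FROM.  The tree's explicit rate
`π_{p_c}(N) ≤ (1 − knEta d)^{iterCount (knLHi d) N}` (`Quant.oneArm_explicit_rate_criticalProbI`) is of log*-type because the
window map `knLHi d m` is a height-2 tower in `m`, and the tower enters the assembly `Quant.slabPerc_of_finiteSizeInputs`
(`…QuantSlabCriterion.lean`, Kozma–Nitzan's Theorem 6 made effective) at exactly one place: the three invocations of the thin
target lemma `Quant.targetLemma_thin` (KN Lemma 10 with additive gluing), whose hypotheses `hk` (Step III: `k` seed trials,
`(1 − p^{seedBound d M})^k ≤ δ`) and `hR` (Step II: `R ≥ 3M + ℓmax + 4 + ⌈(1−p)^{−2d·Ncont d M k}/δ⌉` levels) are the two stacked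
exponentials.  Every other scale constraint of the assembly is LINEAR in the margins.

This file makes that statement a kernel fact by factoring the assembly:

* `Quant.slabPerc_of_thinTargetLemma` — Theorem 6 effective, with the target lemma replaced by ONE hypothesis: a thin
  target-lemma SCHEMA at parameter `p` for the seed `Λ(n)` and half-width `W = 5Ks`, with a FREE margin function `Rof : ℕ → ℕ`
  ("hittability of any wide geometry family `H` from `Λ(n)` on the bounded range `[ℓmax, W]` at tolerance `δx²` gives the linear
  family `∀ δ', TargetPropertyThinAt d p (δ' + 6δx) δ' H R W` for every `R ≥ Rof ℓmax` and every `δx ≥ δmin`").  The seed count,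
  the exponential margins, the uniqueness zone (U) and the orthant faces at scale `M` DISAPPEAR from the hypotheses (they are
  consumed only inside the target lemma); what remains is: tolerances (d-constants), margins `R₀ ≥ Rof M`,
  `R₁ ≥ Rof ℓmax(2K), Rof ℓmax(88)`, the stub increment `s` (linear in `R₀, R₁`), the orthant-face links on `[M, W]` (Lemma 11's own
  input) and the quarter-face hits on `[M, W]`.  Conclusion: KN's slab percolates at the same `p`.
* `Quant.thinTargetLemma_kn` — the schema HOLDS with Kozma–Nitzan's margin
  `Rof ℓmax = 3M + ℓmax + 4 + ⌈(1/(1−p))^{2d·Ncont d M k}/δmin⌉` from (U), the orthant faces at `M` and the seeds (this is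
  `targetLemma_thin`); the `example` at the end re-derives `slabPerc_of_finiteSizeInputs` from the two, so the factorisation is
  faithful.

Consequence (RATE-PLAN §3.3): a polylogarithmic one-arm rate at `p_c` follows from ANY instance of the schema at `p_c` whose margin
function is polynomial (`…QuantPolylogOfTargetSchema.lean`, ARM-1 F2); within the Kozma–Nitzan relay architecture such an instance
needs the junction input (J) (`Quant.JunctionInputAt`) and a no-neck input (N-b) (LADDER R6, CLOSED-NEGATIVE for admissible inputs;
P2-EFFECTIVE-KN §7).  Nothing here claims such an instance.  No definitions; no sorries; standard axioms.
[cite: KozmaNitzan2024, §4 Theorem 6 (pp. 25–31), Lemmas 10–12 (pp. 17–25)]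
-/

noncomputable section

namespace Summit.CriticalPhenomena.PercolationContinuityZ3.Theorems.Quant

open MeasureTheory Literature.Probability.LatticeModels Literature.Probability.Percolation
  Literature.Probability.Percolation.KozmaNitzan
open Literature.Probability.Percolation.GadgetSystem Literature.Probability.Percolation.Contour

variable {d : ℕ}

/-- **Kozma–Nitzan's Theorem 6, effective, from an abstract thin target-lemma schema with a free margin function.**
Dimension `d ≥ 3`, parameter `0 < p < 1`.  Constants as in `slabPerc_of_finiteSizeInputs`: `ε = 2⁻³²`; `K ≥ 20` and tolerances
`δ₂, δc` and `δt, δtq, δq, δe, δeq, δ6q ≥ δmin > 0`, `τ < δmin²`, tied by `(1−δ₂)^K + ε/8 ≤ ε/4`, `δ₂ + 6δt ≤ δc ≤ 1`,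
`δc + 6dδq + 6δe ≤ ε/8`, `τ + (16K−4)·6δtq ≤ δt²`, `τ + 700·6δeq ≤ δe²`, `τ + 44·6δ6q ≤ δc`.  Scales: seed `n`, a scale `M > n`
(the lower end of the input window), margins `R₀ ≥ max(M, Rof M)` (quarter faces) and
`R₁ ≥ Rof (8(3K′ + 3K′R₀ + n + M + 8))` for `K′ ∈ {2K, 88}` (elongated boxes), stub increment
`s ≥ max(1, 2R₁, 100(d+1)(max R₀ R₁ + 1))` with `8(26 + 18R₀ + n + M) ≤ 3Ks`, `n ≤ 3Ks`; `W := 5Ks`.  Hypotheses AT `p`: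
(TL) the thin target-lemma SCHEMA for the seed `Λ(n)`, half-width `W`, tolerance floor `δmin` and margin function `Rof` — for every
`δx ≥ δmin`, every wide family `H` (`loQ ≤ hiQ`, and off any axis some coordinate of `Q`-extent `≥ 2`), every `ℓmax` and
`R ≥ Rof ℓmax`: if every `g ∈ H` is hit from `Λ(n)` at every scale `ℓ ∈ [ℓmax, W]` with probability `> 1 − δx²`, then
`∀ δ', TargetPropertyThinAt d p (δ' + 6δx) δ' H R W`; (F) `1 − τ < P_p(linkEvent Λ_n (orthantFace a τ' n') n')` for all
`n' ∈ [M, W]` (Lemma 11's input); (Q) `1 − τ < P_p(linkIn (ℓQ_g) Λ_n (ℓF_g))` for all quarter-face geometries `g` and `ℓ ∈ [M, W]`.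
Conclusion: for the scheme `S = ⟨⟨d, K, s⟩, p, δc⟩`, `0 < θ_{(ℤ^d)|S.slab}(p)`.  Proof: the assembly of
`slabPerc_of_finiteSizeInputs` verbatim, with its three invocations of `targetLemma_thin` replaced by (TL).  The margin function is
FREE: this is the margin-agnostic form of the criterion (RATE-PLAN §3.4 (P1)); `thinTargetLemma_kn` is the Kozma–Nitzan instance.
builds on p205010 (kernel theorem, internal audit signed; external expert review pending).
[cite: KozmaNitzan2024, §4 Theorem 6 (pp. 25–31), Lemmas 10–12] -/
theorem slabPerc_of_thinTargetLemma (hd : 3 ≤ d) (p : unitInterval) (hp0 : 0 < (p : ℝ))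
    {K : ℕ} (hK20 : 20 ≤ K)
    {δ₂ δc δt δtq δq δe δeq δ6q δmin τ : ℝ}
    (hδ₂1 : δ₂ ≤ 1) (hδc1 : δc ≤ 1)
    (hKε : (1 - δ₂) ^ K + (1 / 2 : ℝ) ^ 32 / 8 ≤ (1 / 2 : ℝ) ^ 32 / 4)
    (hct : δ₂ + 6 * δt ≤ δc)
    (h12 : δc + (d : ℝ) * (6 * δq) + 6 * δe ≤ (1 / 2 : ℝ) ^ 32 / 8)
    (htq : τ + ((8 * (2 * K) - 4 : ℕ) : ℝ) * (6 * δtq) ≤ δt ^ 2)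
    (heq : τ + ((8 * 88 - 4 : ℕ) : ℝ) * (6 * δeq) ≤ δe ^ 2)
    (h6q : τ + ((8 * 6 - 4 : ℕ) : ℝ) * (6 * δ6q) ≤ δc)
    (hδmin0 : 0 < δmin) (hmin_t : δmin ≤ δt) (hmin_tq : δmin ≤ δtq) (hmin_q : δmin ≤ δq)
    (hmin_e : δmin ≤ δe) (hmin_eq : δmin ≤ δeq) (hmin_6q : δmin ≤ δ6q)
    (hτ : τ < δmin ^ 2)
    {n M R₀ R₁ s : ℕ} {Rof : ℕ → ℕ} (hnM : n < M) (hMR₀ : M ≤ R₀) (hR₀ : Rof M ≤ R₀)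
    (hR₁a : Rof (8 * (3 * (2 * K) + 3 * (2 * K) * R₀ + n + M + 8)) ≤ R₁)
    (hR₁b : Rof (8 * (3 * 88 + 3 * 88 * R₀ + n + M + 8)) ≤ R₁)
    (hs1 : 1 ≤ s) (hsR : 2 * R₁ ≤ s) (hs12 : 100 * (d + 1) * (max R₀ R₁ + 1) ≤ s)
    (hs6 : 8 * (3 * 6 + 3 * 6 * R₀ + n + M + 8) ≤ 3 * (K * s)) (hn3 : n ≤ 3 * (K * s))
    (htl : ∀ δx : ℝ, δmin ≤ δx → ∀ H : List (Geom d),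
      (∀ g ∈ H, g.loQ ≤ g.hiQ ∧ ∀ a : Fin d, ∃ i : Fin d, i ≠ a ∧ g.loQ i + 2 ≤ g.hiQ i) →
      ∀ ℓmax R : ℕ, Rof ℓmax ≤ R →
      (∀ g ∈ H, ∀ ℓ : ℕ, ℓmax ≤ ℓ → ℓ ≤ 5 * (K * s) →
        1 - δx ^ 2 < (bondPercolation (zdGraph d) p).real (linkIn (↑(g.Qset ℓ 0)) (box d n) (g.Fset ℓ 0))) →
      ∀ δ' : ℝ, TargetPropertyThinAt d p (δ' + 6 * δx) δ' H R (5 * (K * s)))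
    (hface : ∀ n' : ℕ, M ≤ n' → n' ≤ 5 * (K * s) → ∀ (a : Fin d) (τ' : Fin d → ℤˣ),
      1 - τ < (bondPercolation (zdGraph d) p).real (linkEvent (box d n) (orthantFace a τ' n') n'))
    (hqf : ∀ g ∈ qfList d, ∀ ℓ : ℕ, M ≤ ℓ → ℓ ≤ 5 * (K * s) →
      1 - τ < (bondPercolation (zdGraph d) p).real (linkIn (↑(g.Qset ℓ 0)) (box d n) (g.Fset ℓ 0))) :
    ∃ S : KSch d, S.p = p ∧ S.C.K = K ∧ S.C.s = s ∧ S.δc = δc ∧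
      0 < theta ((zdGraph d).induce S.slab) ⟨0, S.zero_mem_slab⟩ p := by
  classical
  haveI : NeZero d := ⟨by omega⟩
  set ε : ℝ := (1 / 2 : ℝ) ^ 32 with hε
  have hε0 : 0 < ε := by positivity
  set W : ℕ := 5 * (K * s) with hW
  -- tolerance bookkeeping
  have hsq : ∀ δx : ℝ, δmin ≤ δx → τ < δx ^ 2 := fun δx hx =>
    hτ.trans_le (pow_le_pow_left₀ hδmin0.le hx 2)
  -- arithmetic on the scales
  have hMs : M ≤ s := by
    have : max R₀ R₁ + 1 ≤ 100 * (d + 1) * (max R₀ R₁ + 1) := Nat.le_mul_of_pos_left _ (by positivity)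
    have : R₀ ≤ max R₀ R₁ := le_max_left _ _
    omega
  have hsKs : s ≤ K * s := Nat.le_mul_of_pos_left s (by omega)
  have hMW : M ≤ W := by rw [hW]; nlinarith
  -- (1) the quarter-face families (schema at `ℓmax = M`, margin `R₀`)
  have famQ : ∀ δx : ℝ, δmin ≤ δx → ∀ δ' : ℝ, TargetPropertyThinAt d p (δ' + 6 * δx) δ' (qfList d) R₀ W := by
    intro δx hx δ'
    have hτx := hsq δx hx
    refine htl δx hx (qfList d) (wideList_qfList (by omega)) M R₀ hR₀ (fun g hg ℓ h1 h2 => ?_) δ'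
    exact lt_of_le_of_lt (by linarith) (hqf g hg ℓ h1 h2)
  -- (2) elongated boxes are hit (Lemma 11, linear) for aspects `K' ≥ 2`, from the family at tolerance `δx`
  have hitE : ∀ (K' : ℕ) (hK' : 2 ≤ K') (δx : ℝ), δmin ≤ δx → ∀ {r' m' : ℕ},
      8 * (3 * K' + 3 * K' * R₀ + n + M + 8) ≤ r' → r' ≤ W → n ≤ m' → ∀ (a : Fin d) (σ : ℤˣ),
      1 - (τ + ((8 * K' - 4 : ℕ) : ℝ) * (6 * δx)) < (bondPercolation (zdGraph d) p).real
        (linkIn (↑((elongGeom a σ K' (by omega)).Qset r' 0)) (box d m')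
          ((elongGeom a σ K' (by omega)).Fset r' 0)) := by
    intro K' hK' δx hx r' m' hr hrW hm a σ
    exact elongHit_thin p (famQ δx hx) a σ K' hK' (k := n) (n₁ := M) (r := r') (m := m') hrW
      (fun n' h1 h2 a' τ' => hface n' h1 (h2.trans hrW) a' τ') hr hm
  -- (3) the elongated families of aspects `2K` (tolerance `δt`) and `88` (tolerance `δe`), margin `R₁`, from the schema with
  -- Lemma 11 as the hittability input
  have hK2 : 2 ≤ 2 * K := by omega
  have famT : ∀ δ' : ℝ, TargetPropertyThinAt d p (δ' + 6 * δt) δ' (elongList d (2 * K) (by omega)) R₁ W := by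
    intro δ'
    have hτt := hsq δt hmin_t
    refine htl δt hmin_t _ (wideList_elongList hd _ _)
      (8 * (3 * (2 * K) + 3 * (2 * K) * R₀ + n + M + 8)) R₁ hR₁a (fun g hg ℓ h1 h2 => ?_) δ'
    rw [elongList, List.mem_map] at hg
    obtain ⟨x, -, rfl⟩ := hg
    exact lt_of_le_of_lt (by linarith) (hitE (2 * K) hK2 δtq hmin_tq h1 h2 le_rfl x.1 x.2)
  have famE : ∀ δ' : ℝ, TargetPropertyThinAt d p (δ' + 6 * δe) δ' (elongList d 88 (by norm_num)) R₁ W := by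
    intro δ'
    have hτe := hsq δe hmin_e
    refine htl δe hmin_e _ (wideList_elongList hd _ _)
      (8 * (3 * 88 + 3 * 88 * R₀ + n + M + 8)) R₁ hR₁b (fun g hg ℓ h1 h2 => ?_) δ'
    rw [elongList, List.mem_map] at hg
    obtain ⟨x, -, rfl⟩ := hg
    exact lt_of_le_of_lt (by linarith) (hitE 88 (by norm_num) δeq hmin_eq h1 h2 le_rfl x.1 x.2)
  -- (4) the scheme
  set C : Cells d := ⟨hd, K, s, hK20, hs1⟩ with hCdef
  set S : KSch d := ⟨C, p, δc⟩ with hSdef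
  refine ⟨S, rfl, rfl, rfl, rfl, ?_⟩
  have hCr : C.r = K * s := rfl
  have hL : S.scheme.Lawful (zdGraph d) p ε := by
    refine S.lawful (fun du => ?_) (fun h e hV => ?_)
    · -- (32) at the origin: the aspect-6 box is hit from `Λ_{3r}` at scale `3r`
      refine S.hQ0_of_hit du (lt_of_le_of_lt ?_
        (hitE 6 (by norm_num) δ6q hmin_6q (r' := 3 * C.r) (m' := 3 * C.r) ?_ ?_ ?_ (C.axOf du) (σu du)))
      · show 1 - δc ≤ 1 - (τ + ((8 * 6 - 4 : ℕ) : ℝ) * (6 * δ6q)); linarith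
      · rw [hCr]; exact hs6
      · rw [hCr, hW]; omega
      · rw [hCr]; exact hn3
    · refine fail_bound_thin hV hε0.le hδ₂1 (R := R₁) (fun T hT hTr hyp => ?_) ?_ hsR hKε
      · -- Lemma 12, linear, in the weighting of the corridor datum `T` (`T.r = C.r = Ks`)
        have hTr' : T.r = K * s := by rw [hTr]; rfl
        have hc := corridorLemma_thin p (famQ δq hmin_q) famE T hT (wth := W) (by rw [hTr', hW])
          (by rw [hTr']; exact le_trans hs12 hsKs) (δ' := δc) hyp
        refine lt_of_le_of_lt ?_ hc
        show 1 - ε / 8 ≤ 1 - (δc + (d : ℝ) * (6 * δq) + 6 * δe)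
        linarith
      · -- the target lemma for the aspect-`2K` boxes, thin, at (`δc`, `δ₂`)
        show TargetPropertyThinAt d p δc δ₂ (elongList d (2 * K) _) R₁ (5 * (K * s))
        exact (famT δ₂).mono_eps hct
  exact S.theta_slab_pos hL le_rfl hp0 hδc1

/-- **The Kozma–Nitzan instance of the schema.**  At `0 ≤ p < 1`, seed `n < M`, tolerance floor `δmin > 0` and `τ < δmin²`:
from (F) the orthant faces of `Λ_M` linked from `Λ_n` inside `Λ_M` with probability `> 1 − τ`, (U) `P_p(uniqZone n M) > 1 − τ`, and
(d) `k` seeds with `(1 − p^{seedBound d M})^k ≤ δmin`, the thin target-lemma schema of `slabPerc_of_thinTargetLemma` holds for every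
half-width `W` with the margin function `Rof ℓmax = 3M + ℓmax + 4 + ⌈(1/(1−p))^{2d·Ncont d M k}/δmin⌉` — Kozma–Nitzan's Step II
level count on top of Step III's seed count: THE place where the tower of the explicit rate is born.  (`Quant.targetLemma_thin`,
with the tolerance `δx ≥ δmin` and monotonicity of the ceiling.)
builds on p205010 (kernel theorem, internal audit signed; external expert review pending).
[cite: KozmaNitzan2024, §4 Lemma 10 (pp. 17–22)] -/
theorem thinTargetLemma_kn [NeZero d] (p : unitInterval) (hp1 : (p : ℝ) < 1) {δmin τ : ℝ} (hδmin0 : 0 < δmin)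
    (hτ : τ < δmin ^ 2) {n M k W : ℕ} (hnM : n < M)
    (hface : ∀ (a : Fin d) (τ' : Fin d → ℤˣ),
      1 - τ < (bondPercolation (zdGraph d) p).real (linkEvent (box d n) (orthantFace a τ' M) M))
    (huniq : 1 - τ < (bondPercolation (zdGraph d) p).real (uniqZone n M))
    (hk : (1 - (p : ℝ) ^ seedBound d M) ^ k ≤ δmin) :
    ∀ δx : ℝ, δmin ≤ δx → ∀ H : List (Geom d),
      (∀ g ∈ H, g.loQ ≤ g.hiQ ∧ ∀ a : Fin d, ∃ i : Fin d, i ≠ a ∧ g.loQ i + 2 ≤ g.hiQ i) →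
      ∀ ℓmax R : ℕ, 3 * M + ℓmax + 4 + ⌈(1 / (1 - (p : ℝ)) ^ (2 * d * LData.Ncont d M k)) / δmin⌉₊ ≤ R →
      (∀ g ∈ H, ∀ ℓ : ℕ, ℓmax ≤ ℓ → ℓ ≤ W →
        1 - δx ^ 2 < (bondPercolation (zdGraph d) p).real (linkIn (↑(g.Qset ℓ 0)) (box d n) (g.Fset ℓ 0))) →
      ∀ δ' : ℝ, TargetPropertyThinAt d p (δ' + 6 * δx) δ' H R W := by
  intro δx hx H hH ℓmax R hR hhit δ'
  have hδx : 0 < δx := hδmin0.trans_le hx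
  have hτx : τ < δx ^ 2 := hτ.trans_le (pow_le_pow_left₀ hδmin0.le hx 2)
  have hceil : ⌈(1 / (1 - (p : ℝ)) ^ (2 * d * LData.Ncont d M k)) / δx⌉₊ ≤
      ⌈(1 / (1 - (p : ℝ)) ^ (2 * d * LData.Ncont d M k)) / δmin⌉₊ :=
    Nat.ceil_mono (div_le_div_of_nonneg_left (by positivity) hδmin0 hx)
  refine targetLemma_thin p hp1 hδx H hH hnM hhit (fun a τ' => ?_) ?_ (hk.trans hx) ?_ δ'
  · exact lt_of_le_of_lt (by linarith) (hface a τ')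
  · exact lt_of_le_of_lt (by linarith) huniq
  · omega

/-- Faithfulness of the factorisation: `slabPerc_of_finiteSizeInputs` (p208543) is `slabPerc_of_thinTargetLemma` applied to the
Kozma–Nitzan instance `thinTargetLemma_kn` — same hypotheses, same conclusion. -/
example (hd : 3 ≤ d) (p : unitInterval) (hp0 : 0 < (p : ℝ)) (hp1 : (p : ℝ) < 1)
    {K : ℕ} (hK20 : 20 ≤ K)
    {δ₂ δc δt δtq δq δe δeq δ6q δmin τ : ℝ}
    (hδ₂1 : δ₂ ≤ 1) (hδc1 : δc ≤ 1)
    (hKε : (1 - δ₂) ^ K + (1 / 2 : ℝ) ^ 32 / 8 ≤ (1 / 2 : ℝ) ^ 32 / 4)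
    (hct : δ₂ + 6 * δt ≤ δc)
    (h12 : δc + (d : ℝ) * (6 * δq) + 6 * δe ≤ (1 / 2 : ℝ) ^ 32 / 8)
    (htq : τ + ((8 * (2 * K) - 4 : ℕ) : ℝ) * (6 * δtq) ≤ δt ^ 2)
    (heq : τ + ((8 * 88 - 4 : ℕ) : ℝ) * (6 * δeq) ≤ δe ^ 2)
    (h6q : τ + ((8 * 6 - 4 : ℕ) : ℝ) * (6 * δ6q) ≤ δc)
    (hδmin0 : 0 < δmin) (hmin_t : δmin ≤ δt) (hmin_tq : δmin ≤ δtq) (hmin_q : δmin ≤ δq)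
    (hmin_e : δmin ≤ δe) (hmin_eq : δmin ≤ δeq) (hmin_6q : δmin ≤ δ6q)
    (hτ : τ < δmin ^ 2)
    {n M k R₀ R₁ s : ℕ} (hnM : n < M)
    (hk : (1 - (p : ℝ) ^ seedBound d M) ^ k ≤ δmin)
    (hR₀ : 3 * M + M + 4 + ⌈(1 / (1 - (p : ℝ)) ^ (2 * d * LData.Ncont d M k)) / δmin⌉₊ ≤ R₀)
    (hR₁a : 3 * M + 8 * (3 * (2 * K) + 3 * (2 * K) * R₀ + n + M + 8) + 4 +
      ⌈(1 / (1 - (p : ℝ)) ^ (2 * d * LData.Ncont d M k)) / δmin⌉₊ ≤ R₁)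
    (hR₁b : 3 * M + 8 * (3 * 88 + 3 * 88 * R₀ + n + M + 8) + 4 +
      ⌈(1 / (1 - (p : ℝ)) ^ (2 * d * LData.Ncont d M k)) / δmin⌉₊ ≤ R₁)
    (hs1 : 1 ≤ s) (hsR : 2 * R₁ ≤ s) (hs12 : 100 * (d + 1) * (max R₀ R₁ + 1) ≤ s)
    (hs6 : 8 * (3 * 6 + 3 * 6 * R₀ + n + M + 8) ≤ 3 * (K * s)) (hn3 : n ≤ 3 * (K * s))
    (huniq : 1 - τ < (bondPercolation (zdGraph d) p).real (uniqZone n M))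
    (hface : ∀ n' : ℕ, M ≤ n' → n' ≤ 5 * (K * s) → ∀ (a : Fin d) (τ' : Fin d → ℤˣ),
      1 - τ < (bondPercolation (zdGraph d) p).real (linkEvent (box d n) (orthantFace a τ' n') n'))
    (hqf : ∀ g ∈ qfList d, ∀ ℓ : ℕ, M ≤ ℓ → ℓ ≤ 5 * (K * s) →
      1 - τ < (bondPercolation (zdGraph d) p).real (linkIn (↑(g.Qset ℓ 0)) (box d n) (g.Fset ℓ 0))) :
    ∃ S : KSch d, S.p = p ∧ S.C.K = K ∧ S.C.s = s ∧ S.δc = δc ∧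
      0 < theta ((zdGraph d).induce S.slab) ⟨0, S.zero_mem_slab⟩ p := by
  haveI : NeZero d := ⟨by omega⟩
  have hMW : M ≤ 5 * (K * s) := by
    have : max R₀ R₁ + 1 ≤ 100 * (d + 1) * (max R₀ R₁ + 1) := Nat.le_mul_of_pos_left _ (by positivity)
    have : R₀ ≤ max R₀ R₁ := le_max_left _ _
    have hsKs : s ≤ K * s := Nat.le_mul_of_pos_left s (by omega)
    omega
  exact slabPerc_of_thinTargetLemma hd p hp0 hK20 hδ₂1 hδc1 hKε hct h12 htq heq h6q hδmin0 hmin_t hmin_tq hmin_q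
    hmin_e hmin_eq hmin_6q hτ (Rof := fun ℓmax => 3 * M + ℓmax + 4 +
      ⌈(1 / (1 - (p : ℝ)) ^ (2 * d * LData.Ncont d M k)) / δmin⌉₊) hnM (by omega) hR₀ hR₁a hR₁b hs1 hsR hs12 hs6 hn3
    (thinTargetLemma_kn p hp1 hδmin0 hτ hnM (fun a τ' => hface M le_rfl hMW a τ') huniq hk) hface hqf

end Summit.CriticalPhenomena.PercolationContinuityZ3.Theorems.Quant

end
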